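import Mathlib
import Literature.Computability.Complexity.Classes
import Literature.Computability.Complexity.Promise
import Literature.Computability.MetaComplexity.LevinKt
import Literature.Computability.MetaComplexity.BranchingPrograms
import Literature.Computability.MetaComplexity.OliveiraPichSanthanam2019.GapMKtPMagnification
import HarnessLib

/-!
# Oliveira–Pich–Santhanam, `Gap-MKtP` vs branching programs (ToC 2021, Thm 1.1 item 7, Thm 1.2 item 3)

Literature: I. C. Oliveira, J. Pich, R. Santhanam, *Hardness magnification near state-of-the-art lower
bounds*, Theory of Computing 17(11), 2021 [bib: `OliveiraPichSanthanam2021`], p. 4 ("BP[s] denotes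
deterministic branching programs of size at most s") and p. 5:

* **Theorem 1.1 item 7.** *"There is a universal constant c ≥ 1 for which the following hold. If
  there exists ε > 0 such that for every small enough β > 0 … (7) Gap-MKtP[2^{βn}, 2^{βn} + cn] ∉
  BP[N^{2+ε}], then EXP ⊄ BP[poly]."*
* **Theorem 1.2 item 3.** *"For every ε > 0 there exists δ > 0 for which the following results hold:
  … (3) Gap-MKtP[2^{(1-δ)n}, 2^{n-1}] ∉ BP[N^{2-ε}]."* (proof: Appendix 5.2, Impagliazzo–Meka–
  Zuckerman PRGs for branching programs + Allender's observation.)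

Rendering: exactly as in `GapMKtPMagnification.lean` (integer `Kt`, `⌊·⌋` thresholds, `∀ U` first
with `c`, `δ` depending on `U`; the lower bound in TAIL form), with `BP[s]` = `BPSIZEae s`
(`BranchingPrograms.lean`: deterministic branching programs, size = inner nodes, almost everywhere,
inhabited by `headLang_mem_BPSIZEae`). Size-convention robustness: counting sinks (`+2`) or edges
(`×2`) instead of inner nodes changes `BP[s]` by at most `s ↦ 2s + 2`; since `2⌊N^{2-ε}⌋ + 2 ≤
N^{2-ε/2}` for large `N`, the `∀ ε ∃ δ` form of Theorem 1.2(3) together with the tail form makes the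
typed fact a consequence of print under any of these conventions, and the hypothesis of Theorem 1.1(7)
(`∃ ε`, `N^{2+ε}`) is likewise convention-insensitive.

Census (cell `pub-magnif`) row R18: T `thm11_item7` with OPEN hypothesis `MKtPBPHypothesis U c` (gap
Prop); K `thm12_item3` (large parameters; PARAM-MISMATCH with the threshold in the authors' words,
p. 6 — no small-parameter BP analogue of Theorem 1.3 is stated in print).
-/

namespace Literature.Computability.MetaComplexity.OliveiraPichSanthanam2019

open Literature.Computability.Complexity Literature.Computability.MetaComplexity
open UniversalMachine

/-- **`Gap-MKtP[2^{βn}, 2^{βn} + cn] ∉ BP[N^{κ}]`** (item 7 uses `κ = 2 + ε`).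
[cite: OliveiraPichSanthanam2021, Thm. 1.1 item 7 (hypothesis)] -/
def GapMKtPBPLB (U : UniversalMachine) (c : ℕ) (κ β : ℝ) : Prop :=
  U.gapMKtP (powThreshold β) (powLogThreshold β c) ∉ promiseLift (BPSIZEae (powSize κ))

/-- **Hypothesis of Theorem 1.1 item 7** (OPEN — census row R18): *"there exists ε > 0 such that for
every small enough β > 0, Gap-MKtP[2^{βn}, 2^{βn} + cn] ∉ BP[N^{2+ε}]"*.
[cite: OliveiraPichSanthanam2021, Thm. 1.1 item 7 (hypothesis)] -/
def MKtPBPHypothesis (U : UniversalMachine) (c : ℕ) : Prop :=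
  ∃ ε : ℝ, 0 < ε ∧ ∃ β₀ : ℝ, 0 < β₀ ∧ ∀ β : ℝ, 0 < β → β < β₀ → GapMKtPBPLB U c (2 + ε) β

/-- `EXP ⊄ BP[poly]`: some language in `EXP` has no polynomial-size deterministic branching
programs (a.e. classes absorb constants, so `⋃ₖ BPSIZEae (N ↦ N^k)` is polynomial size).
[cite: OliveiraPichSanthanam2021, Thm. 1.1 item 7 (conclusion)] -/
def EXPNotInBPPoly : Prop :=
  ∃ L ∈ EXP, ∀ k : ℕ, L ∉ BPSIZEae fun N => N ^ k

/-- **Oliveira–Pich–Santhanam, Theorem 1.1 item 7** as a named fact: *"… (7) Gap-MKtP[2^{βn},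
2^{βn} + cn] ∉ BP[N^{2+ε}], then EXP ⊄ BP[poly]."* Users take `(h : thm11_item7)`.
[cite: OliveiraPichSanthanam2021, Thm. 1.1 item 7] -/
def thm11_item7 : Prop :=
  ∀ U : UniversalMachine, ∃ c : ℕ, 1 ≤ c ∧ (MKtPBPHypothesis U c → EXPNotInBPPoly)

/-- **Oliveira–Pich–Santhanam, Theorem 1.2 item 3** (PROVED, vendored as a named fact): *"For every
ε > 0 there exists δ > 0 for which the following results hold: … (3) Gap-MKtP[2^{(1-δ)n}, 2^{n-1}] ∉
BP[N^{2-ε}]."* Thresholds YES `Kt ≤ ⌊N^{1-δ}⌋`, NO `Kt > N/2`, size `⌊N^{2-ε}⌋` inner nodes; TAIL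
form (the thresholds are ordered only for `N > 2^{1/δ}`, cf. `GapMKtPMagnification.lean`, TAILS).
[cite: OliveiraPichSanthanam2021, Thm. 1.2 item 3] -/
def thm12_item3 : Prop :=
  ∀ U : UniversalMachine, ∀ ε : ℝ, 0 < ε → ∃ δ : ℝ, 0 < δ ∧ ∀ N₀ : ℕ,
    (U.gapMKtP (powThreshold (1 - δ)) (fun N => N / 2)).tailFrom N₀ ∉
      promiseLift (BPSIZEae (powSize (2 - ε)))

/-! ### API -/

/-- **Consequence shape, item 7.** [cite: OliveiraPichSanthanam2021, Thm. 1.1 item 7] -/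
theorem expNotInBPPoly_of_forall (h : thm11_item7) (U : UniversalMachine)
    (hlb : ∀ c : ℕ, 1 ≤ c → MKtPBPHypothesis U c) : EXPNotInBPPoly := by
  obtain ⟨c, hc, himp⟩ := h U
  exact himp (hlb c hc)

/-- The BP lower bound is antitone in the size exponent. [folklore] -/
theorem GapMKtPBPLB.anti {U : UniversalMachine} {c : ℕ} {κ κ' β : ℝ} (hκ : κ ≤ κ')
    (h : GapMKtPBPLB U c κ' β) : GapMKtPBPLB U c κ β := by
  intro hmem
  apply h
  refine promiseLift_mono (BPSIZEae_mono ⟨1, fun n hn => ?_⟩) hmem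
  unfold powSize
  exact Nat.floor_le_floor (Real.rpow_le_rpow_of_exponent_le (by exact_mod_cast hn) hκ)

end Literature.Computability.MetaComplexity.OliveiraPichSanthanam2019
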